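import Literature.Computability.AlgebraicComplexity.NilCoxeterParabolic
import Literature.Computability.AlgebraicComplexity.BorderRankRestriction
import Literature.Barriers.MatrixMultiplication.IrreversibilityBarrierProofs
import HarnessLib

/-!
# The upper step bound `bR(T_{NC_{n+1}}) ≤ (n+1)² · bR(T_{NC_n})` along the parabolic tower

Topic `Literature/Computability/AlgebraicComplexity` (companion of `NilCoxeterParabolic.lean`; wanted by route
`MatrixMultiplication/NilCoxeterShadow`, items `stmt-MatrixMultiplication-0956/0958`, whose inductive engine
`InductiveCosetGrowth` posits the LOWER step bound `bR(T_{NC_{n+1}}) ≥ (n+1)^{1+δ} · bR(T_{NC_n})`). Everything here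
is PROVED.

Writing `π[p, z]` for the parabolic parametrisation of `S_{n+1}` by `Fin (n+1) × S_n` (the permutation with the
letter `last` at position `p` and pattern `z`; Mathlib term `(finSuccEquiv' p).trans
      ((Equiv.optionCongr z).trans
(finSuccEquiv' last).symm)`, as in `NilCoxeterParabolic.lean`, no new definition), `x̂ = π[last, x]` for the embedding
`S_n ⊂ S_{n+1}` and `c_p = π[p, 1]` for the minimal-length coset representatives (`π[p, x] = x̂ · c_p`, lengths add):

* `nilCoxeterTensor_assoc` — associativity of the structure constants of `NC_m`:
  `∑_v T(o; a, v) T(v; b, c) = ∑_u T(u; a, b) T(o; u, c)` (both sides are `[abc = o ∧ ℓ(o) = ℓ(a)+ℓ(b)+ℓ(c)]`,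
  by the subadditivity `ℓ(xy) ≤ ℓ(x) + ℓ(y)`); i.e. `NC_m` IS an associative algebra (Humphreys 1990, §7.1).
* `nilCoxeterTensor_last_cosetRep` — `T(u; x̂, c_p) = [u = π[p, x]]` (the normal form `T_{π[p,x]} = T_{x̂} T_{c_p}`).
* `nilCoxeterTensor_parabolic_left` — **the left factor in normal form**:
  `T(π[q,z]; π[p,x]; w) = ∑_y T_{NC_n}(z; x, y) · T(π[q,y]; c_p; w)`, i.e.
  `T_{π[p,x]} · T_w = T_{x̂} · (T_{c_p} T_w)`: the LEFT `NC_n`-action (`nilCoxeterTensor_parabolic`: `n+1` copies of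
  `T_{NC_n}`, one per coset layer `q`) applied to the LINEAR image `T_{c_p} T_w` of the right factor.
* `tensorRestrictsTo_multiple_nilCoxeterTensor`, `tensorRestrictsTo_nilCoxeterTensor_succ` — hence
  `T_{NC_{n+1}} ≤ ⟨n+1⟩ ⊗ ⟨n+1⟩ ⊗ T_{NC_n}` (a restriction of `(n+1)²` copies of `T_{NC_n}`, indexed by the coset
  layer `p` of the left factor and the layer `q` of the output), and
* `algBorderRank_nilCoxeterTensor_succ_le` — **`bR(T_{NC_{n+1}}) ≤ (n+1)² · bR(T_{NC_n})`** over any field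
  (border rank over `K[ε]`, Bläser 2013 Def. 6.1, is monotone under restriction and submultiplicative under `⊗`,
  `bR⟨f⟩ ≤ f`). Iterated: `bR(T_{NC_n}) ≤ (n!)²`.

This is the "`(n+1)²` products in `NC_n` per level of the parabolic recursion" of the route's strategy census
(N1) as a kernel-checked tensor restriction: a linear-overhead recursion (`TameRecursion`, which refutes the
route's thesis) would have to compress exactly this structured `⟨1, n+1, n+1⟩`-product over `NC_n` from
`(n+1)²` to `O(n+1)` copies. Together with the engine it would sandwich the step ratio:
`(n+1)^{1+δ} ≤ bR(T_{NC_{n+1}})/bR(T_{NC_n}) ≤ (n+1)²`.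

## References

* J. E. Humphreys, *Reflection Groups and Coxeter Groups*, CUP 1990, §7.1 (generic algebras are associative;
  `T_w = T_{s_1} ⋯ T_{s_k}` along reduced words) and §1.6 Ex. 1(b) (subadditivity of length). [Humphreys1990]
* A. Björner, F. Brenti, *Combinatorics of Coxeter Groups*, GTM 231, Springer 2005, Prop. 2.4.4
  (`w = w^J w_J`, lengths add). [BjornerBrenti2005]
* M. Bläser, *Fast Matrix Multiplication*, Theory of Computing Graduate Surveys 5 (2013), Def. 6.1, Thm. 6.3(3)
  (product rule for approximate decompositions), Notation 7.6 (`f ⊙ t = ⟨f⟩ ⊗ t`). [Blaser2013]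
-/

noncomputable section

open scoped BigOperators

namespace Literature.Computability.AlgebraicComplexity

universe u

variable {n : ℕ}

/-! ## Associativity of the nil-Coxeter structure constants -/

section Assoc

variable (K : Type u) [CommSemiring K]

/-- **Associativity of `NC_m` in structure constants**: `∑_v T(o; a, v) T(v; b, c) = ∑_u T(u; a, b) T(o; u, c)`.
Only `v = bc` and `u = ab` contribute, and both sides equal `[abc = o ∧ ℓ(o) = ℓ(a) + ℓ(b) + ℓ(c)]`: if
`ℓ(o) = ℓ(a) + ℓ(bc)` and `ℓ(bc) = ℓ(b) + ℓ(c)` then `ℓ(ab) ≥ ℓ(o) - ℓ(c) = ℓ(a) + ℓ(b)`, so `ℓ(ab) = ℓ(a) + ℓ(b)` and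
`ℓ(o) = ℓ(ab) + ℓ(c)` by subadditivity (`inversionNumber_mul_le`), and symmetrically.
[cite: Humphreys1990, §7.1, Theorem] -/
theorem nilCoxeterTensor_assoc {m : ℕ} (o a b c : Equiv.Perm (Fin m)) :
    ∑ v, nilCoxeterTensor K m o a v * nilCoxeterTensor K m v b c =
      ∑ u, nilCoxeterTensor K m u a b * nilCoxeterTensor K m o u c := by
  have hL : ∑ v, nilCoxeterTensor K m o a v * nilCoxeterTensor K m v b c =
      nilCoxeterTensor K m o a (b * c) * nilCoxeterTensor K m (b * c) b c := by
    refine Finset.sum_eq_single (b * c) (fun v _ hv => ?_) (by simp)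
    rw [nilCoxeterTensor_apply_of_ne (z := v) (x := b) (y := c) (fun h => hv h.symm), mul_zero]
  have hR : ∑ u, nilCoxeterTensor K m u a b * nilCoxeterTensor K m o u c =
      nilCoxeterTensor K m (a * b) a b * nilCoxeterTensor K m o (a * b) c := by
    refine Finset.sum_eq_single (a * b) (fun u _ hu => ?_) (by simp)
    rw [nilCoxeterTensor_apply_of_ne (z := u) (x := a) (y := b) (fun h => hu h.symm), zero_mul]
  rw [hL, hR]
  have hab : inversionNumber (a * b) ≤ inversionNumber a + inversionNumber b := inversionNumber_mul_le a b
  have hbc : inversionNumber (b * c) ≤ inversionNumber b + inversionNumber c := inversionNumber_mul_le b c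
  have h1 : inversionNumber (a * (b * c)) ≤ inversionNumber a + inversionNumber (b * c) :=
    inversionNumber_mul_le a (b * c)
  have h2 : inversionNumber (a * (b * c)) ≤ inversionNumber (a * b) + inversionNumber c := by
    rw [← mul_assoc]
    exact inversionNumber_mul_le (a * b) c
  simp only [nilCoxeterTensor_apply, mul_assoc, true_and]
  by_cases ho : a * (b * c) = o
  · subst ho
    simp only [true_and]
    split_ifs <;> first | rfl | (exfalso; omega) | simp
  · simp only [ho, false_and, if_false, zero_mul, mul_zero]

end Assoc

/-! ## The parabolic normal form of the left factor -/

section Parabolic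

variable (K : Type u) [CommSemiring K]

/-- **The parametrisation `(p, z) ↦ π[p, z]` is a bijection `Fin (n+1) × S_n ≃ S_{n+1}`** (injective by
`parabolic_injective`, and `(n+1) · n! = (n+1)!`). [cite: BjornerBrenti2005, Prop. 2.4.4] -/
theorem parabolic_bijective (n : ℕ) :
    Function.Bijective (fun a : Fin (n + 1) × Equiv.Perm (Fin n) =>
      ((((finSuccEquiv' (a.1)).trans ((Equiv.optionCongr (a.2)).trans (finSuccEquiv' (Fin.last
            n)).symm))) : Equiv.Perm (Fin (n + 1)))) := by
  rw [Fintype.bijective_iff_injective_and_card]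
  refine ⟨fun a b h => Prod.ext (parabolic_injective h).1 (parabolic_injective h).2, ?_⟩
  rw [Fintype.card_prod, Fintype.card_fin, Fintype.card_perm, Fintype.card_perm, Fintype.card_fin,
    Fintype.card_fin, Nat.factorial_succ]

/-- **`T(u; x̂, c_p) = [u = π[p, x]]`**: the normal form `T_{π[p,x]} = T_{x̂} · T_{c_p}` (`x̂ · c_p = π[p, x]` by
`parabolic_last_mul`, and the lengths `ℓ(x) + (n - p)` add by `inversionNumber_parabolic`).
[cite: BjornerBrenti2005, Prop. 2.4.4] -/
theorem nilCoxeterTensor_last_cosetRep (p : Fin (n + 1)) (x : Equiv.Perm (Fin n))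
    (u : Equiv.Perm (Fin (n + 1))) :
    nilCoxeterTensor K (n + 1) u (((finSuccEquiv' (Fin.last n)).trans ((Equiv.optionCongr
          (x)).trans (finSuccEquiv' (Fin.last n)).symm))) (((finSuccEquiv' (p)).trans
          ((Equiv.optionCongr ((1 : Equiv.Perm (Fin n)))).trans (finSuccEquiv' (Fin.last
          n)).symm))) =
      if u = ((finSuccEquiv' (p)).trans ((Equiv.optionCongr (x)).trans (finSuccEquiv' (Fin.last
            n)).symm)) then 1 else 0 := by
  rw [nilCoxeterTensor_apply, parabolic_last_mul, mul_one]
  by_cases hu : u = ((finSuccEquiv' (p)).trans ((Equiv.optionCongr (x)).trans (finSuccEquiv'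
        (Fin.last n)).symm))
  · subst hu
    rw [if_pos rfl, if_pos]
    refine ⟨rfl, ?_⟩
    rw [inversionNumber_parabolic, inversionNumber_parabolic, inversionNumber_parabolic, inversionNumber_one]
    simp only [Fin.val_last, Nat.sub_self, add_zero, zero_add]
  · rw [if_neg hu, if_neg]
    rintro ⟨h, -⟩
    exact hu h.symm

/-- **The left factor in parabolic normal form**:
`T_{NC_{n+1}}(π[q,z]; π[p,x]; w) = ∑_y T_{NC_n}(z; x, y) · T_{NC_{n+1}}(π[q,y]; c_p; w)` — i.e.
`T_{π[p,x]} T_w = T_{x̂} (T_{c_p} T_w)` (associativity), where left multiplication by `x̂ ∈ S_n` acts on each coset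
layer `q` by the multiplication table of `NC_n` (`nilCoxeterTensor_parabolic`). [cite: BjornerBrenti2005, Prop. 2.4.4] -/
theorem nilCoxeterTensor_parabolic_left (p q : Fin (n + 1)) (z x : Equiv.Perm (Fin n))
    (w : Equiv.Perm (Fin (n + 1))) :
    nilCoxeterTensor K (n + 1) (((finSuccEquiv' (q)).trans ((Equiv.optionCongr (z)).trans
          (finSuccEquiv' (Fin.last n)).symm))) (((finSuccEquiv' (p)).trans ((Equiv.optionCongr
          (x)).trans (finSuccEquiv' (Fin.last n)).symm))) w =
      ∑ y, nilCoxeterTensor K n z x y *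
        nilCoxeterTensor K (n + 1) (((finSuccEquiv' (q)).trans ((Equiv.optionCongr (y)).trans
              (finSuccEquiv' (Fin.last n)).symm))) (((finSuccEquiv' (p)).trans ((Equiv.optionCongr
              ((1 : Equiv.Perm (Fin n)))).trans (finSuccEquiv' (Fin.last n)).symm))) w := by
  have hassoc := nilCoxeterTensor_assoc K (((finSuccEquiv' (q)).trans ((Equiv.optionCongr
        (z)).trans (finSuccEquiv' (Fin.last n)).symm))) (((finSuccEquiv' (Fin.last n)).trans
        ((Equiv.optionCongr (x)).trans (finSuccEquiv' (Fin.last n)).symm))) (((finSuccEquiv'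
        (p)).trans ((Equiv.optionCongr ((1 : Equiv.Perm (Fin n)))).trans (finSuccEquiv' (Fin.last
        n)).symm))) w
  -- the right-hand side of associativity collapses at `u = π[p, x]`
  have hR : ∑ u, nilCoxeterTensor K (n + 1) u (((finSuccEquiv' (Fin.last n)).trans
        ((Equiv.optionCongr (x)).trans (finSuccEquiv' (Fin.last n)).symm))) (((finSuccEquiv'
        (p)).trans ((Equiv.optionCongr ((1 : Equiv.Perm (Fin n)))).trans (finSuccEquiv' (Fin.last
        n)).symm))) *
      nilCoxeterTensor K (n + 1) (((finSuccEquiv' (q)).trans ((Equiv.optionCongr (z)).trans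
            (finSuccEquiv' (Fin.last n)).symm))) u w = nilCoxeterTensor K (n + 1) (((finSuccEquiv'
            (q)).trans ((Equiv.optionCongr (z)).trans (finSuccEquiv' (Fin.last n)).symm)))
            (((finSuccEquiv' (p)).trans ((Equiv.optionCongr (x)).trans (finSuccEquiv' (Fin.last
            n)).symm))) w := by
    simp only [nilCoxeterTensor_last_cosetRep, ite_mul, one_mul, zero_mul, Finset.sum_ite_eq',
      Finset.mem_univ, if_true]
  -- the left-hand side, reindexed by the parametrisation, is the sum over the layer `q`
  have hL : ∑ v, nilCoxeterTensor K (n + 1) (((finSuccEquiv' (q)).trans ((Equiv.optionCongr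
        (z)).trans (finSuccEquiv' (Fin.last n)).symm))) (((finSuccEquiv' (Fin.last n)).trans
        ((Equiv.optionCongr (x)).trans (finSuccEquiv' (Fin.last n)).symm))) v *
      nilCoxeterTensor K (n + 1) v (((finSuccEquiv' (p)).trans ((Equiv.optionCongr ((1 : Equiv.Perm
            (Fin n)))).trans (finSuccEquiv' (Fin.last n)).symm))) w =
      ∑ y, nilCoxeterTensor K n z x y *
        nilCoxeterTensor K (n + 1) (((finSuccEquiv' (q)).trans ((Equiv.optionCongr (y)).trans
              (finSuccEquiv' (Fin.last n)).symm))) (((finSuccEquiv' (p)).trans ((Equiv.optionCongr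
              ((1 : Equiv.Perm (Fin n)))).trans (finSuccEquiv' (Fin.last n)).symm))) w := by
    rw [← (Equiv.ofBijective _ (parabolic_bijective n)).sum_comp]
    simp only [Equiv.ofBijective_apply]
    rw [Fintype.sum_prod_type, Finset.sum_comm]
    simp only [nilCoxeterTensor_parabolic, ite_mul, zero_mul, Finset.sum_ite_eq, Finset.mem_univ, if_true]
  rw [hL, hR] at hassoc
  exact hassoc.symm

end Parabolic

/-! ## `T_{NC_{n+1}} ≤ ⟨n+1⟩ ⊗ ⟨n+1⟩ ⊗ T_{NC_n}` and the upper step bound -/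

section Upper

variable (K : Type u) [Field K]

/-- **The intermediate tensor is a restriction of `⟨n+1⟩ ⊗ (⟨n+1⟩ ⊗ T_{NC_n})`**: the tensor
`((q,z), (p,x), w) ↦ ∑_y T_{NC_n}(z; x, y) · T(π[q,y]; c_p; w)` is obtained from the `(n+1)²` block-diagonal copies
of `T_{NC_n}` (blocks `(p, q)`) by: summing the output over `p`, sharing the left factor across `q`, and the linear
map `w ↦ (T(π[q,y]; c_p; w))_{p,q,y}` on the right factor. [cite: Blaser2013, Notation 7.6] -/
theorem tensorRestrictsTo_multiple_nilCoxeterTensor (n : ℕ) :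
    TensorRestrictsTo
      (kroneckerTensor (unitTensor K (n + 1)) (kroneckerTensor (unitTensor K (n + 1)) (nilCoxeterTensor K n)))
      (fun (o l : Fin (n + 1) × Equiv.Perm (Fin n)) (r : Equiv.Perm (Fin (n + 1))) =>
        ∑ y, nilCoxeterTensor K n o.2 l.2 y *
          nilCoxeterTensor K (n + 1) (((finSuccEquiv' (o.1)).trans ((Equiv.optionCongr (y)).trans
                (finSuccEquiv' (Fin.last n)).symm))) (((finSuccEquiv' (l.1)).trans
                ((Equiv.optionCongr ((1 : Equiv.Perm (Fin n)))).trans (finSuccEquiv' (Fin.last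
                n)).symm))) r) := by
  classical
  refine ⟨fun o a => if a.2.1 = o.1 then (if a.2.2 = o.2 then 1 else 0) else 0,
    fun l b => if b.1 = l.1 then (if b.2.2 = l.2 then 1 else 0) else 0,
    fun r c => nilCoxeterTensor K (n + 1) (((finSuccEquiv' (c.2.1)).trans ((Equiv.optionCongr
          (c.2.2)).trans (finSuccEquiv' (Fin.last n)).symm))) (((finSuccEquiv' (c.1)).trans
          ((Equiv.optionCongr ((1 : Equiv.Perm (Fin n)))).trans (finSuccEquiv' (Fin.last
          n)).symm))) r,
    fun o l r => ?_⟩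
  simp only [kroneckerTensor_unitTensor_apply, Fintype.sum_prod_type, ite_and]
  simp only [ite_mul, one_mul, zero_mul, mul_ite, mul_one, mul_zero, Finset.sum_ite_irrel,
    Finset.sum_const_zero, Finset.sum_ite_eq, Finset.sum_ite_eq', Finset.mem_univ, if_true]
  exact Finset.sum_congr rfl fun y _ => mul_comm _ _

/-- **`T_{NC_{n+1}}` is a restriction of `⟨n+1⟩ ⊗ ⟨n+1⟩ ⊗ T_{NC_n}`** (relabel output and left factor by the
parametrisation and use `nilCoxeterTensor_parabolic_left`). [cite: Blaser2013, Notation 7.6] -/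
theorem tensorRestrictsTo_nilCoxeterTensor_succ (n : ℕ) :
    TensorRestrictsTo
      (kroneckerTensor (unitTensor K (n + 1)) (kroneckerTensor (unitTensor K (n + 1)) (nilCoxeterTensor K n)))
      (nilCoxeterTensor K (n + 1)) := by
  classical
  set e := Equiv.ofBijective _ (parabolic_bijective n) with he
  refine (tensorRestrictsTo_multiple_nilCoxeterTensor K n).trans ?_
  have h := tensorRestrictsTo_precomp
    (fun (o l : Fin (n + 1) × Equiv.Perm (Fin n)) (r : Equiv.Perm (Fin (n + 1))) =>
      ∑ y, nilCoxeterTensor K n o.2 l.2 y *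
        nilCoxeterTensor K (n + 1) (((finSuccEquiv' (o.1)).trans ((Equiv.optionCongr (y)).trans
              (finSuccEquiv' (Fin.last n)).symm))) (((finSuccEquiv' (l.1)).trans
              ((Equiv.optionCongr ((1 : Equiv.Perm (Fin n)))).trans (finSuccEquiv' (Fin.last
              n)).symm))) r)
    e.symm e.symm (id : Equiv.Perm (Fin (n + 1)) → Equiv.Perm (Fin (n + 1)))
  convert h using 1
  funext o l r
  obtain ⟨⟨q, z⟩, rfl⟩ := e.surjective o
  obtain ⟨⟨p, x⟩, rfl⟩ := e.surjective l
  simp only [Equiv.symm_apply_apply, id]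
  rw [he, Equiv.ofBijective_apply, Equiv.ofBijective_apply]
  exact nilCoxeterTensor_parabolic_left K p q z x r

/-- `bR(⟨f⟩ ⊗ t) ≤ f · bR(t)` over `K[ε]` (submultiplicativity and `bR⟨f⟩ ≤ R⟨f⟩ ≤ f`). [cite: Blaser2013, Thm. 6.3] -/
theorem algBorderRank_multiple_le {ι κ μ : Type*} [Fintype ι] [Fintype κ] [Fintype μ] [DecidableEq ι]
    [DecidableEq κ] [DecidableEq μ] (f : ℕ) (t : ι → κ → μ → K) :
    algBorderRank (kroneckerTensor (unitTensor K f) t) ≤ f * algBorderRank t := by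
  refine (algBorderRank_kroneckerTensor_le _ _).trans (Nat.mul_le_mul_right _ ?_)
  exact (algBorderRank_le_tensorRank _).trans
    (Literature.Barriers.MatrixMultiplication.tensorRank_unitTensor_le f)

/-- **The upper step bound `bR(T_{NC_{n+1}}) ≤ (n+1)² · bR(T_{NC_n})`** (border rank over `K[ε]`, Bläser 2013
Def. 6.1): restriction `T_{NC_{n+1}} ≤ ⟨n+1⟩ ⊗ ⟨n+1⟩ ⊗ T_{NC_n}` and `bR(⟨f⟩ ⊗ t) ≤ f · bR(t)` twice.
[cite: Blaser2013, Def. 6.1] -/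
theorem algBorderRank_nilCoxeterTensor_succ_le (n : ℕ) :
    algBorderRank (nilCoxeterTensor K (n + 1)) ≤ (n + 1) ^ 2 * algBorderRank (nilCoxeterTensor K n) := by
  classical
  calc algBorderRank (nilCoxeterTensor K (n + 1))
      ≤ algBorderRank (kroneckerTensor (unitTensor K (n + 1))
          (kroneckerTensor (unitTensor K (n + 1)) (nilCoxeterTensor K n))) :=
        (tensorRestrictsTo_nilCoxeterTensor_succ K n).algBorderRank_le
    _ ≤ (n + 1) * algBorderRank (kroneckerTensor (unitTensor K (n + 1)) (nilCoxeterTensor K n)) :=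
        algBorderRank_multiple_le K _ _
    _ ≤ (n + 1) * ((n + 1) * algBorderRank (nilCoxeterTensor K n)) :=
        Nat.mul_le_mul_left _ (algBorderRank_multiple_le K _ _)
    _ = (n + 1) ^ 2 * algBorderRank (nilCoxeterTensor K n) := by ring

/-- **`bR(T_{NC_n}) ≤ (n!)²`** unconditionally (iterate the step bound from `bR(T_{NC_0}) ≤ 1`). [cite: Blaser2013, Def. 6.1] -/
theorem algBorderRank_nilCoxeterTensor_le_factorial_sq (n : ℕ) :
    algBorderRank (nilCoxeterTensor K n) ≤ n.factorial ^ 2 := by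
  classical
  induction n with
  | zero =>
    -- `S_0` is a point: the format is `1 × 1 × 1`, so `bR ≤ R ≤ 1`
    refine (algBorderRank_le_tensorRank _).trans ?_
    refine (tensorRank_le_card_of_eq_sum (t := nilCoxeterTensor K 0) (fun _ _ => (1 : K)) (fun _ _ => 1)
      (fun (_ : Fin 1) _ => 1) ?_).trans (by simp)
    funext a b c
    rw [Finset.sum_apply, Finset.sum_apply, Finset.sum_apply, Fin.sum_univ_one, triad_apply,
      nilCoxeterTensor_apply, if_pos]
    · ring
    · exact ⟨Subsingleton.elim _ _, by simp [Subsingleton.elim a 1, Subsingleton.elim b 1, Subsingleton.elim c 1]⟩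
  | succ m ih =>
    calc algBorderRank (nilCoxeterTensor K (m + 1)) ≤ (m + 1) ^ 2 * algBorderRank (nilCoxeterTensor K m) :=
          algBorderRank_nilCoxeterTensor_succ_le K m
      _ ≤ (m + 1) ^ 2 * m.factorial ^ 2 := Nat.mul_le_mul_left _ ih
      _ = (m + 1).factorial ^ 2 := by rw [Nat.factorial_succ]; ring

end Upper

end Literature.Computability.AlgebraicComplexity

end
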